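import Summits.ResolutionOfSingularities.ResolutionOfSingularities.Theorems.MarkedTransferCampaignW46MohWindowShade
import HarnessLib

/-!
# [OURS · L1 W4.6] Rung (iii) "Moh window" for the classical pair — the TERMINAL (coordinate-monomial)
  case inside the window: stability, the equimultiplicity test, and termination when no proper centre
  exists (all dimensions); the two-multiplicity game for surfaces

Cell `res-hironaka`, rung L, slot W4.6, seat `res-L1-s46-pv-6` (gen 2).  Companion of
`MarkedTransferCampaignW46MohWindowShade.lean` (gen 0: no increase of the shade inside `p ≤ ord₀ F < 2p`)
and `MarkedTransferCampaignW46MohWindowShadeExit.lean` (gen 2: the bottom edge).  Gen 0's theorems are the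
NO-INCREASE half of the role of Eq. (127) for the classical pair (lane-B note, desk #35); this file is the
DECREASE / TERMINATION half in the terminal case — "monomial case: `F = x^{r_x} y^{r_y} · u`, `u` a unit …
the pair `(o, c)` can be lowered by a combinatorially given resolution process" [HauserPerlega2024, §3] —
read in the tree's transcription of [Hauser2010, §§F–G] (`PointBlowup.State/step/shade/IsEquimultiplePoint/
newMult`, `PointBlowupShade.lean`; `x^p + F(y)`, `F` cleaned, exceptional monomial `y^r ∣ F`).  A
COORDINATE-MONOMIAL state is `y^r ∣ F` with `ord₀ F = |r|` (shade `0`: `F = y^r · u`, `u(0) ≠ 0`).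
OURS; replaces — for regime (iii) of RESCUE-SEED W4.6, the classical pair and the terminal case — the ROLE
of Th. 16.6 (2) / Eq. (127) (ms. p. 84 l. 10–20) and of the termination clause of Th. 16.13 (p. 87
l. 25–29); NOT a statement of the manuscript [claim: Hironaka2017, status: under-review], nothing of which
is used.  AI review is weaker than expert review.

## What is proved (prime `p`, field `K` of char. `p`, finite `σ`; coordinate-monomial state, `p < |r| < 2p`)

* `coeff_newMult_pointTransform_ne_zero` / `coeff_newMult_step_ne_zero`: at EVERY point `b` of every
  chart `y_j` (`b_j = 0`) the new exceptional monomial `y^{r'}`, `r' = newMult` (`r'_j = |r| − p`,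
  `r'_i = r_i` if `b_i = 0`, `0` otherwise), occurs in the transform with coefficient
  `c · ∏_{b_i ≠ 0} b_i^{r_i} ≠ 0` and SURVIVES the cleaning — because `0 < r'_j = |r| − p < p`.  (At
  `|r| = 2p` it need not: the monomial kangaroo `r = (p−1, p+1)` of the tree's
  `PointBlowupMohBoundAttained` is exactly the deleted case; the window enters here and only here.)
* `ordZero_step_eq_of_shade_zero`, `shade_step_eq_zero_of_shade_zero`: so the new state is again
  coordinate-monomial, `ord₀ F' = |r'|`, shade `0` — the terminal case is STABLE under all point blow-ups
  inside the window, in the given coordinates, equimultiple or not;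
* `isEquimultiplePoint_iff_of_shade_zero`: the point is equimultiple iff `p ≤ |r'|`.  The classical pair's
  dynamics in the terminal case is therefore the explicit game `r ↦ r'` on exceptional multiplicities
  ("combinatorial resolution", [HauserPerlega2024, §3 (2)]; [BierstoneMilman2008, §5 Step I Case B]).
* `degree_newMult_add` (every state of order `o ≥ p`): `|r'| + r_j + p = o + |r|_{b = 0}`.
* THE DICHOTOMY.  Either some PROPER set of exceptional components has total multiplicity `≥ p` — then the
  coordinate subspace they cut out (with `x = 0`) is a positive-dimensional centre along which `x^p + y^r u`
  is `p`-fold, the case of gen 0's centre theorem `MohWindowShadeCentres.shade_step_le_of_window_centre` —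
  or (`degree_step_r_lt_of_sum_erase_lt`, `sum_erase_step_lt_of_forall`) EVERY equimultiple point blow-up
  strictly lowers `|r| = ord₀ F` and leads to a state of the same kind; whence
  `length_le_of_noProperCentre`: every walk of equimultiple point blow-ups from such a state has length
  `≤ |r| − p < p`.
* Surfaces (`σ = {j, i}`, the explicit two-multiplicity game): in the companion
  `MarkedTransferCampaignW46MohWindowShadeExit.lean` §2.

Honest scope.  Coordinates are the GIVEN ones of the atlas model: "terminal" means coordinate-monomial; the
monomial case up to a change of subordinate parameters ([HauserPerlega2024, §3]) is not detected — e.g.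
`x² + y₁(y₁ + y₂ + y₁y₂)²`, `r = (1, 0)`, `p = 2`, order `3`, repeats identically at the point `y₂ = 1` of
the `y₁`-chart (seat's Python twin of the engine, cell dir `L/res-L1-s46-pv-6/py/`): it is monomial in the
parameters `(y₁, y₁ + y₂ + y₁y₂)` and its `p`-fold locus is a curve.  Barriers: `ResidualOrderUnboundedNarrow.
mohStability_fails_for_each_e` (`e ≥ 3`; here `e = 1`); `PointBlowupMohBoundAttained` /
`KangarooShadeIncrease.Hauser2003_kangarooShadeIncrease` (order `≥ 2p`, excluded by the window as said).
-/

noncomputable section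

set_option linter.dupNamespace false -- mandated namespace of this single-conjunct summit

open MvPolynomial Finset

open scoped BigOperators

namespace Summit.ResolutionOfSingularities.ResolutionOfSingularities.Theorems.CampaignW46.MohWindowShadeTerminal

open Literature.AlgebraicGeometry.Resolution
open Literature.AlgebraicGeometry.Resolution.PointBlowup
open Literature.AlgebraicGeometry.Resolution.Hauser2010
open Literature.AlgebraicGeometry.Resolution.HauserPerlega2019 (initialForm)
open Literature.Barriers.ResolutionOfSingularities (ordZero_le_of_coeff_ne_zero le_ordZero_of_forall)

variable {σ : Type*} {K : Type*} [Field K] [Fintype σ] [DecidableEq σ] [DecidableEq K]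
variable (p : ℕ) [hp : Fact p.Prime] [CharP K p]

/-! ## §1. Terminal (coordinate-monomial) states inside the window -/

omit [Fintype σ] hp [CharP K p] in
/-- The new exceptional multiplicities, pointwise: `r'_k = (|r|… ) ` — precisely
`r'_k = (if b_k = 0 then (if k = j then o − p else r_k) else 0)`. [folklore] -/
theorem step_r_apply (j : σ) (b : σ → K) (hbj : b j = 0) (s : State σ K) {o : ℕ}
    (ho : ordZero s.F = o) (k : σ) :
    (step p j b s).r k = if b k = 0 then (if k = j then o - p else s.r k) else 0 := by
  show newMult p j b s k = _
  rw [newMult_eq p j b hbj s ho, Finsupp.filter_apply, Finsupp.update_apply]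

omit hp [CharP K p] in
/-- **[OURS · L1 W4.6] Bookkeeping of the exceptional multiplicities (every state).**  At the point `b`
of the chart `y_j` of the blow-up of a state of order `o ≥ p`:  `|r'| + r_j + p = o + |r|_{b=0}`, where
`|r|_{b=0} = Σ_{b_i = 0} r_i` counts the components through the point (including `j`).  NOT a statement
of the manuscript. [folklore] -/
theorem degree_newMult_add (j : σ) (b : σ → K) (hbj : b j = 0) (s : State σ K) {o : ℕ}
    (ho : ordZero s.F = o) (hpo : p ≤ o) :
    (step p j b s).r.degree + s.r j + p = o + (s.r.filter fun i => b i = 0).degree := by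
  classical
  have h1 : (step p j b s).r.degree = (o - p) + ∑ i ∈ univ.erase j, (step p j b s).r i := by
    rw [degree_eq_add_sum_erase j, step_r_apply p j b hbj s ho j, if_pos hbj, if_pos rfl]
  have h2 : (s.r.filter fun i => b i = 0).degree
      = s.r j + ∑ i ∈ univ.erase j, (s.r.filter fun i => b i = 0) i := by
    rw [degree_eq_add_sum_erase j, Finsupp.filter_apply, if_pos hbj]
  have h3 : ∑ i ∈ univ.erase j, (step p j b s).r i
      = ∑ i ∈ univ.erase j, (s.r.filter fun i => b i = 0) i := by
    refine Finset.sum_congr rfl fun i hi => ?_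
    rw [step_r_apply p j b hbj s ho i, Finsupp.filter_apply, if_neg (Finset.ne_of_mem_erase hi)]
  rw [h1, h2, h3]
  omega

omit [DecidableEq σ] [DecidableEq K] hp [CharP K p] in
/-- In a coordinate-monomial state (`y^r ∣ F`, `ord₀ F = |r|`: shade `0`) the exceptional monomial
`y^r` itself occurs in `F` (with the unit's constant coefficient). [folklore] -/
theorem coeff_r_ne_zero_of_shade_zero (s : State σ K) (hr : ∀ d ∈ s.F.support, s.r ≤ d)
    (hord : ordZero s.F = (s.r.degree : ℕ)) : coeff s.r s.F ≠ 0 := by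
  obtain ⟨⟨d, hd, hdeg⟩, -⟩ := (ordZero_eq_nat_iff _ _).mp hord
  have hle : s.r ≤ d := hr d (MvPolynomial.mem_support_iff.mpr hd)
  by_contra h0
  have hne : s.r ≠ d := by rintro h; rw [h] at h0; exact hd h0
  have hlt : s.r < d := lt_of_le_of_ne hle hne
  have := degree_lt_degree_of_lt hlt
  omega

omit hp [CharP K p] in
/-- **[OURS · L1 W4.6] The new exceptional monomial occurs in the transform.**  For a coordinate-monomial
state (`y^r ∣ F`, `ord₀ F = |r|`) with `p < |r|`, at every point `b` of every chart `y_j` (`b_j = 0`) the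
monomial `y^{r'}`, `r' = newMult`, has coefficient `c · ∏_{b_i ≠ 0} b_i^{r_i} ≠ 0` (`c` = the
coefficient of `y^r` in `F`) in the translated chart transform: the unit `∏_{b_i ≠ 0}(y_i + b_i)^{r_i}`
contributes its constant term, and no other monomial of `F` reaches the `y_j`-layer `|r| − p`.  NOT a
statement of the manuscript. [folklore] -/
theorem coeff_newMult_pointTransform_ne_zero (j : σ) (b : σ → K) (hbj : b j = 0) (s : State σ K)
    (hr : ∀ d ∈ s.F.support, s.r ≤ d) (hord : ordZero s.F = (s.r.degree : ℕ))
    (hlo : p < s.r.degree) : coeff (step p j b s).r (pointTransform p j b s) ≠ 0 := by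
  classical
  have hc : coeff s.r s.F ≠ 0 := coeff_r_ne_zero_of_shade_zero s hr hord
  have hrF : s.r ∈ s.F.support := MvPolynomial.mem_support_iff.mpr hc
  rw [pointTransform_eq_sum, coeff_sum, Finset.sum_eq_single_of_mem s.r hrF]
  · rw [WeightedBlowup.coeff_translate_monomial]
    refine mul_ne_zero hc ?_
    rw [Finset.prod_ne_zero_iff]
    intro i _
    by_cases hbi : b i = 0
    · have h1 : (step p j b s).r i = chartExponent p j s.r i := by
        rw [step_r_apply p j b hbj s hord i, chartExponent_apply, if_pos hbi]
      rw [h1, Nat.choose_self, Nat.sub_self, pow_zero, Nat.cast_one, mul_one]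
      exact one_ne_zero
    · have hij : i ≠ j := by rintro rfl; exact hbi hbj
      have h1 : (step p j b s).r i = 0 := by
        rw [step_r_apply p j b hbj s hord i, if_neg hbi]
      rw [h1, Nat.choose_zero_right, Nat.sub_zero, Nat.cast_one, one_mul, chartExponent_apply,
        if_neg hij]
      exact pow_ne_zero _ hbi
  · intro d hd hne
    by_contra h
    have hj := apply_eq_of_coeff_translate_monomial_ne_zero b hbj h
    rw [step_r_apply p j b hbj s hord j, if_pos hbj, if_pos rfl, chartExponent_apply, if_pos rfl] at hj
    have hle : s.r ≤ d := hr d hd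
    have hlt : s.r < d := lt_of_le_of_ne hle (Ne.symm hne)
    have hdeg := degree_lt_degree_of_lt hlt
    omega

omit hp [CharP K p] in
/-- **[OURS · L1 W4.6] … and survives the cleaning, INSIDE THE WINDOW.**  With `p < |r| < 2p` the new
multiplicity `r'_j = |r| − p` lies strictly between `0` and `p`, so `y^{r'}` is not a `p`-th power and the
cleaning keeps it: `coeff_{r'} F' ≠ 0`.  (At `|r| = 2p` this fails — the monomial kangaroo
`r = (p−1, p+1)` of `PointBlowupMohBoundAttained` — which is why the window is the hypothesis.)  NOT a
statement of the manuscript. [folklore] -/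
theorem coeff_newMult_step_ne_zero (j : σ) (b : σ → K) (hbj : b j = 0) (s : State σ K)
    (hr : ∀ d ∈ s.F.support, s.r ≤ d) (hord : ordZero s.F = (s.r.degree : ℕ))
    (hlo : p < s.r.degree) (hhi : s.r.degree < 2 * p) :
    coeff (step p j b s).r (step p j b s).F ≠ 0 := by
  change coeff (step p j b s).r (deletePthPowers p (pointTransform p j b s)) ≠ 0
  rw [coeff_deletePthPowers, if_neg]
  · exact coeff_newMult_pointTransform_ne_zero p j b hbj s hr hord hlo
  · intro hP
    have hj := (isPthPowerExponent_iff _ _).mp hP j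
    rw [step_r_apply p j b hbj s hord j, if_pos hbj, if_pos rfl] at hj
    have h1 : 0 < s.r.degree - p := by omega
    have h2 := Nat.le_of_dvd h1 hj
    omega

omit hp [CharP K p] in
/-- **[OURS · L1 W4.6] The terminal case is stable inside the window: the new order is `|r'|`.**  NOT a
statement of the manuscript. [folklore] -/
theorem ordZero_step_eq_of_shade_zero (j : σ) (b : σ → K) (hbj : b j = 0) (s : State σ K)
    (hr : ∀ d ∈ s.F.support, s.r ≤ d) (hord : ordZero s.F = (s.r.degree : ℕ))
    (hlo : p < s.r.degree) (hhi : s.r.degree < 2 * p) :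
    ordZero (step p j b s).F = ((step p j b s).r.degree : ℕ) := by
  refine le_antisymm (ordZero_le_of_coeff_ne_zero _ _
    (coeff_newMult_step_ne_zero p j b hbj s hr hord hlo hhi)) ?_
  refine le_ordZero_of_forall _ _ fun E hE => ?_
  exact degree_le_degree_of_le
    (newMult_le_of_mem_support_step p j b hbj s hord hr E (MvPolynomial.mem_support_iff.mpr hE))

omit hp [CharP K p] in
/-- **[OURS · L1 W4.6] … and the new shade is `0` again.**  Inside the window a coordinate-monomial state
steps to a coordinate-monomial state at every point of every chart (equimultiple or not).  NOT a statement
of the manuscript. [folklore] -/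
theorem shade_step_eq_zero_of_shade_zero (j : σ) (b : σ → K) (hbj : b j = 0) (s : State σ K)
    (hr : ∀ d ∈ s.F.support, s.r ≤ d) (hord : ordZero s.F = (s.r.degree : ℕ))
    (hlo : p < s.r.degree) (hhi : s.r.degree < 2 * p) : (step p j b s).shade = 0 := by
  unfold State.shade
  rw [ordZero_step_eq_of_shade_zero p j b hbj s hr hord hlo hhi, tsub_self]

omit hp [CharP K p] in
/-- **[OURS · L1 W4.6] The equimultiplicity test in the terminal case: `p ≤ |r'|`.**  For a
coordinate-monomial state with `p < |r|`, the point `b` of the chart `y_j` is equimultiple iff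
`p ≤ |r'| = (|r| − p) + Σ_{i ≠ j, b_i = 0} r_i`.  NOT a statement of the manuscript. [folklore] -/
theorem isEquimultiplePoint_iff_of_shade_zero (j : σ) (b : σ → K) (hbj : b j = 0) (s : State σ K)
    (hr : ∀ d ∈ s.F.support, s.r ≤ d) (hord : ordZero s.F = (s.r.degree : ℕ))
    (hlo : p < s.r.degree) :
    IsEquimultiplePoint p j b s ↔ p ≤ (step p j b s).r.degree := by
  classical
  constructor
  · intro heq
    by_contra hlt
    have h0 : (step p j b s).r ≠ 0 := by
      intro h
      have := congrArg (fun f => f j) h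
      simp only [Finsupp.coe_zero, Pi.zero_apply] at this
      rw [step_r_apply p j b hbj s hord j, if_pos hbj, if_pos rfl] at this
      omega
    exact coeff_newMult_pointTransform_ne_zero p j b hbj s hr hord hlo
      (heq _ h0 (not_le.mp hlt))
  · intro hle d hd0 hdeg
    by_contra hne
    rw [pointTransform_eq_sum, coeff_sum] at hne
    obtain ⟨e, he, hne'⟩ := Finset.exists_ne_zero_of_sum_ne_zero hne
    have hrd : (step p j b s).r ≤ d := by
      rw [Finsupp.le_def]
      intro i
      rw [step_r_apply p j b hbj s hord i]
      by_cases hbi : b i = 0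
      · rw [if_pos hbi]
        have heq : d i = chartExponent p j e i :=
          apply_eq_of_coeff_translate_monomial_ne_zero b hbi hne'
        rw [heq, chartExponent_apply]
        have h1 := le_degree_of_ordZero_eq s hord e he
        have h2 := Finsupp.le_def.mp (hr e he) i
        by_cases hij : i = j
        · rw [if_pos hij, if_pos hij]; omega
        · rw [if_neg hij, if_neg hij]; exact h2
      · rw [if_neg hbi]; exact Nat.zero_le _
    have := degree_le_degree_of_le hrd
    omega

omit hp [CharP K p] in
/-- **[OURS · L1 W4.6] No proper centre ⟹ the order drops.**  If the components other than `{y_j = 0}`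
have total multiplicity `< p` (so that no coordinate subspace through the point strictly larger than the
point lies in the `p`-fold locus on their account), then at the point `b` of the chart `y_j` the new total
multiplicity is smaller: `|r'| < o`.  NOT a statement of the manuscript. [folklore] -/
theorem degree_step_r_lt_of_sum_erase_lt (j : σ) (b : σ → K) (hbj : b j = 0) (s : State σ K) {o : ℕ}
    (ho : ordZero s.F = o) (hpo : p ≤ o) (hj : ∑ i ∈ univ.erase j, s.r i < p) :
    (step p j b s).r.degree < o := by
  classical
  have h1 : (step p j b s).r.degree = (o - p) + ∑ i ∈ univ.erase j, (step p j b s).r i := by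
    rw [degree_eq_add_sum_erase j, step_r_apply p j b hbj s ho j, if_pos hbj, if_pos rfl]
  have h2 : ∑ i ∈ univ.erase j, (step p j b s).r i ≤ ∑ i ∈ univ.erase j, s.r i := by
    refine Finset.sum_le_sum fun i hi => ?_
    rw [step_r_apply p j b hbj s ho i, if_neg (Finset.ne_of_mem_erase hi)]
    split_ifs
    · exact le_rfl
    · exact Nat.zero_le _
  omega

omit hp [CharP K p] in
/-- **[OURS · L1 W4.6] "No proper centre" is inherited.**  If EVERY proper set of exceptional components
has total multiplicity `< p` (equivalently: for every `k`, `Σ_{i ≠ k} r_i < p`) in a coordinate-monomial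
state of order `|r| ≥ p`, then the same holds after the step at any point of any chart.  NOT a statement
of the manuscript. [folklore] -/
theorem sum_erase_step_lt_of_forall (j : σ) (b : σ → K) (hbj : b j = 0) (s : State σ K)
    (hord : ordZero s.F = (s.r.degree : ℕ)) (hlo : p ≤ s.r.degree)
    (hnpc : ∀ k, ∑ i ∈ univ.erase k, s.r i < p) (k : σ) :
    ∑ i ∈ univ.erase k, (step p j b s).r i < p := by
  classical
  have hterm : ∀ i, i ≠ j → (step p j b s).r i ≤ s.r i := by
    intro i hij
    rw [step_r_apply p j b hbj s hord i, if_neg hij]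
    split_ifs
    · exact le_rfl
    · exact Nat.zero_le _
  by_cases hkj : k = j
  · subst hkj
    refine lt_of_le_of_lt (Finset.sum_le_sum fun i hi => hterm i (Finset.ne_of_mem_erase hi)) (hnpc k)
  · have hjmem : j ∈ univ.erase k := Finset.mem_erase.mpr ⟨Ne.symm hkj, Finset.mem_univ j⟩
    have hkmem : k ∈ univ.erase j := Finset.mem_erase.mpr ⟨hkj, Finset.mem_univ k⟩
    have hA := hnpc k
    have hB := hnpc j
    rw [← Finset.add_sum_erase _ _ hjmem] at hA ⊢
    rw [← Finset.add_sum_erase _ _ hkmem] at hB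
    have hset : (univ.erase j).erase k = (univ.erase k).erase j := Finset.erase_right_comm
    rw [hset] at hB
    have ho : s.r.degree = s.r k + (s.r j + ∑ i ∈ (univ.erase k).erase j, s.r i) := by
      rw [degree_eq_add_sum_erase k, ← Finset.add_sum_erase _ _ hjmem]
    have hrj : (step p j b s).r j = s.r.degree - p := by
      rw [step_r_apply p j b hbj s hord j, if_pos hbj, if_pos rfl]
    have hT : ∑ i ∈ (univ.erase k).erase j, (step p j b s).r i
        ≤ ∑ i ∈ (univ.erase k).erase j, s.r i :=
      Finset.sum_le_sum fun i hi => hterm i (Finset.ne_of_mem_erase hi)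
    rw [hrj]
    omega

/-- **[OURS · L1 W4.6] TERMINATION of the terminal case inside the window when no proper centre exists
(all dimensions).**  Let `s₀, s₁, …` be states with `s_{n+1} = step p (j n) (b n) (s n)`, `b n (j n) = 0`,
starting from a cleaned coordinate-monomial state (`y^r ∣ F`, `ord₀ F = |r|`) inside the window
(`p < |r| < 2p`) in which every proper set of exceptional components has total multiplicity `< p`.  If the
first `N` points are equimultiple, then `N + p ≤ |r₀|`: every walk of `p`-fold points from `s₀` has fewer
than `|r₀| − p < p` steps.  (Along the walk the state stays of the same kind, `|r|` drops at every step,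
and the bottom edge `|r| = p` admits no equimultiple point — gen 0's `no_lost_component_of_ordZero_eq`
would need `r_j = 0`.)  Replaces, for the classical pair in the terminal case, the role of the termination
clause Th. 16.13 (p. 87) in regime (iii); NOT a statement of the manuscript. [folklore] -/
theorem length_le_of_noProperCentre (s : ℕ → State σ K) (j : ℕ → σ) (b : ℕ → σ → K)
    (hb : ∀ n, b n (j n) = 0) (hstep : ∀ n, s (n + 1) = step p (j n) (b n) (s n))
    (hclean : deletePthPowers p (s 0).F = (s 0).F) (hr : ∀ d ∈ (s 0).F.support, (s 0).r ≤ d)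
    (hord : ordZero (s 0).F = ((s 0).r.degree : ℕ)) (hlo : p < (s 0).r.degree)
    (hhi : (s 0).r.degree < 2 * p) (hnpc : ∀ k, ∑ i ∈ univ.erase k, (s 0).r i < p) {N : ℕ}
    (heq : ∀ n, n < N → IsEquimultiplePoint p (j n) (b n) (s n)) :
    N + p ≤ (s 0).r.degree := by
  classical
  -- the invariant along the walk
  have hinv : ∀ n, n ≤ N →
      deletePthPowers p (s n).F = (s n).F ∧ (∀ d ∈ (s n).F.support, (s n).r ≤ d) ∧
      ordZero (s n).F = ((s n).r.degree : ℕ) ∧ (∀ k, ∑ i ∈ univ.erase k, (s n).r i < p) ∧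
      p ≤ (s n).r.degree ∧ (s n).r.degree + n ≤ (s 0).r.degree := by
    intro n
    induction n with
    | zero => intro _; exact ⟨hclean, hr, hord, hnpc, hlo.le, le_rfl⟩
    | succ n ih =>
      intro hn
      obtain ⟨h1, h2, h3, h4, h5, h6⟩ := ih (by omega)
      have heqn := heq n (by omega)
      -- the bottom edge admits no equimultiple point under `hnpc`
      have hlt : p < (s n).r.degree := by
        rcases h5.lt_or_eq with h | h
        · exact h
        · exfalso
          have hordp : ordZero (s n).F = p := by rw [h3, ← h]
          have hrj := (MohWindowShade.no_lost_component_of_ordZero_eq p (j n) (b n) (hb n) (s n)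
            h1 hordp h2 heqn).1
          have hsum := h4 (j n)
          have hdeg := degree_eq_add_sum_erase (j n) (s n).r
          omega
      have hhi' : (s n).r.degree < 2 * p := by omega
      rw [hstep n]
      refine ⟨deletePthPowers_step p (j n) (b n) (s n),
        newMult_le_of_mem_support_step p (j n) (b n) (hb n) (s n) h3 h2,
        ordZero_step_eq_of_shade_zero p (j n) (b n) (hb n) (s n) h2 h3 hlt hhi',
        sum_erase_step_lt_of_forall p (j n) (b n) (hb n) (s n) h3 h5 h4,
        (isEquimultiplePoint_iff_of_shade_zero p (j n) (b n) (hb n) (s n) h2 h3 hlt).mp heqn, ?_⟩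
      have := degree_step_r_lt_of_sum_erase_lt p (j n) (b n) (hb n) (s n) h3 h5 (h4 (j n))
      omega
  obtain ⟨-, -, -, -, h5, h6⟩ := hinv N le_rfl
  omega

end Summit.ResolutionOfSingularities.ResolutionOfSingularities.Theorems.CampaignW46.MohWindowShadeTerminal
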